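import Literature.AnabelianGeometry.EtaleTheta.ContH1Complements
import HarnessLib

/-!
# Continuous `H¹` and complements, II: equivariance for free when conjugation is a pointwise limit of
# power maps ([EtTh] §1: `(Π^tp_X)^Θ` acts on `Δ_Θ ≅ Ẑ(1)` through the cyclotomic character)

PROOF-ONLY sequel (seat abc-iut-L2-t12, gen 4) of `ContH1Complements.lean`. There,
`ThetaSetting.res_deltaTheta_surjective_of_complement` derives the clause `res_deltaTheta_surjective` of
[EtTh] Prop. 1.5 (i)/(ii) (`Prop15i`/`Prop15ii`, abc-iut-L2-t1) from a topological splitting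
`H' = Δ_Θ ⋊ K` PLUS the `K`-equivariance of the continuous endomorphisms of `Δ_Θ`. In [EtTh] §1 the
group `(Π^tp_X)^Θ` acts on "`Δ_Θ (≅ Ẑ(1))`" (PRIMS PDF p. 12) through the cyclotomic character:
conjugation by `k` is `a ↦ a^{χ(k)}` with `χ(k) ∈ Ẑ^×` a LIMIT OF INTEGERS. Along such a limit every
continuous endomorphism is automatically equivariant (`c(lim aⁿⁱ) = lim c(a)ⁿⁱ`), so the equivariance
binder disappears:

* `ContH1.cocycle_map_mul_self` / `cocycle_map_zpow_self` — a continuous cocycle `A → A` of the abelian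
  `A` acting on itself is multiplicative, hence commutes with integer powers;
* `ContH1.coe_apply_eq_conj_of_tendsto_zpow` — it commutes with every conjugation that is a pointwise
  limit of power maps along one non-trivial filter on `ℤ` (Hausdorff group);
* `ContH1.res_surjective_of_complement_of_tendsto_zpow`,
  `ThetaSetting.res_deltaTheta_surjective_of_complement_of_tendsto_zpow` — restriction
  `H¹(H', Δ_Θ) → H¹(Δ_Θ, Δ_Θ)` is SURJECTIVE as soon as `H' = Δ_Θ ⋊ K` topologically with `K` acting on
  `Δ_Θ` by pointwise limits of power maps.

Classical ([cite: Brown1982CohomologyGroups, Ch. IV §2 Prop. 2.1 and Prop. 2.3]); [EtTh] locator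
[cite: MochizukiEtTh2009, Prop 1.5 (i) p.23]. HONEST FRAMING: nothing of [EtTh] is asserted or denied; no
side taken on [IUTchIII] Cor. 3.12; typed ≠ proved.
-/

namespace Literature.AnabelianGeometry.EtaleTheta

open scoped IsMulCommutative
open Filter Topology

namespace ContH1

section PowerLimit

variable {G : Type*} [Group G] [TopologicalSpace G] [IsTopologicalGroup G]
  {A : Subgroup G} [A.Normal] [IsMulCommutative A]

/-- A continuous cocycle of the abelian `A` acting on itself by conjugation is MULTIPLICATIVE:
`c(ab) = c(a) c(b)` (the action is trivial). [cite: Brown1982CohomologyGroups, Ch. IV §2 Prop. 2.1 and Prop. 2.3] -/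
theorem cocycle_map_mul_self (c : contCocycles (MonoidHom.id G) A A) (a b : A) :
    c.1 (a * b) = c.1 a * c.1 b := by
  rw [c.2.2]
  congr 1
  apply Subtype.ext
  rw [MulAut.conjNormal_apply, MonoidHom.id_apply, ← Subgroup.coe_mul, mul_comm a, Subgroup.coe_mul,
    mul_inv_cancel_right]

/-- Hence it commutes with integer powers: `c(aⁿ) = c(a)ⁿ`.
[cite: Brown1982CohomologyGroups, Ch. IV §2 Prop. 2.1 and Prop. 2.3] -/
theorem cocycle_map_zpow_self (c : contCocycles (MonoidHom.id G) A A) (a : A) (n : ℤ) :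
    c.1 (a ^ n) = c.1 a ^ n :=
  map_zpow (MonoidHom.mk' c.1 (cocycle_map_mul_self c)) a n

/-- **Continuous endomorphisms commute with pointwise limits of power maps.** If conjugation by `k` on
`A` is, along one non-trivial filter `l` on `ℤ`, the pointwise limit of the power maps `a ↦ aⁿ`
(a cyclotome `A ≅ Ẑ(1)` on which `k` acts through `χ(k) = lim nᵢ`), then every continuous cocycle
`c : A → A` is `k`-equivariant: `c(k a k⁻¹) = k c(a) k⁻¹`.
[cite: Brown1982CohomologyGroups, Ch. IV §2 Prop. 2.1 and Prop. 2.3] -/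
theorem coe_apply_eq_conj_of_tendsto_zpow [T2Space G] (c : contCocycles (MonoidHom.id G) A A)
    {k : G} {l : Filter ℤ} [l.NeBot]
    (hk : ∀ a a' : A, k * a * k⁻¹ = a' → Tendsto (fun n : ℤ => a ^ n) l (𝓝 a'))
    (a a' : A) (h : k * a * k⁻¹ = a') : ((c.1 a' : A) : G) = k * c.1 a * k⁻¹ := by
  have hmem : k * (c.1 a : G) * k⁻¹ ∈ A := (inferInstance : A.Normal).conj_mem _ (c.1 a).2 k
  have h1 : Tendsto (fun n : ℤ => c.1 (a ^ n)) l (𝓝 (c.1 a')) :=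
    (c.2.1.tendsto a').comp (hk a a' h)
  have h2 : Tendsto (fun n : ℤ => c.1 (a ^ n)) l (𝓝 ⟨k * c.1 a * k⁻¹, hmem⟩) := by
    simp only [cocycle_map_zpow_self]
    exact hk (c.1 a) ⟨_, hmem⟩ rfl
  exact congrArg Subtype.val (tendsto_nhds_unique h1 h2)

/-- **Surjectivity of restriction with no equivariance binder**: `H = A ⋊ K` topologically (`A` the
coefficients, `φ = id`, continuous `A`-coordinate), every `k ∈ K` conjugating `A` by a pointwise limit of
power maps ⇒ `res : H¹(H, A) → H¹(A, A)` is surjective.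
[cite: Brown1982CohomologyGroups, Ch. IV §2 Prop. 2.1 and Prop. 2.3] -/
theorem res_surjective_of_complement_of_tendsto_zpow [T2Space G] {H K : Subgroup G} (hAH : A ≤ H)
    (hdisj : Disjoint A K) (π : H → A) (hπK : ∀ h : H, ((π h : G))⁻¹ * (h : G) ∈ K)
    (hπc : Continuous π)
    (hpow : ∀ k : G, k ∈ K → ∃ l : Filter ℤ, l.NeBot ∧
      ∀ a a' : A, k * a * k⁻¹ = a' → Tendsto (fun n : ℤ => a ^ n) l (𝓝 a')) :
    Function.Surjective (ContH1.res (MonoidHom.id G) A hAH) := by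
  refine res_surjective_of_complement (φ := MonoidHom.id G) hAH Subgroup.le_normalizer_of_normal hdisj
    π hπK hπc fun c k hk a a' h => ?_
  obtain ⟨l, hl, hkl⟩ := hpow k hk
  rw [MonoidHom.id_apply]
  exact coe_apply_eq_conj_of_tendsto_zpow c hkl a a' h

end PowerLimit

end ContH1

namespace ThetaSetting

open Literature.AnabelianGeometry.SemiGraphs

variable {p : ℕ} [Fact p.Prime] {D : ThetaSetting p}

/-- **`F⁰/F¹ = Hom(Δ_Θ, Δ_Θ)` at a cyclotomic splitting.** If `H' = Δ_Θ ⋊ K` topologically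
(`Δ_Θ ≤ H' ≤ (Π^tp_X)^Θ`, continuous `Δ_Θ`-coordinate) and each `k ∈ K` conjugates `Δ_Θ` by a pointwise
limit of power maps (the cyclotomic character on "`Δ_Θ (≅ Ẑ(1))`", p. 12), then restriction
`H¹(H', Δ_Θ) → H¹(Δ_Θ, Δ_Θ)` is surjective — the clause `res_deltaTheta_surjective` of `Prop15i`/`Prop15ii`
with NO residual binder beyond the splitting ("`F⁰/F¹ = Hom(Δ_Θ, Δ_Θ) = Ẑ · log(Θ)`", Prop. 1.5 (i)(ii),
p. 23; `(Π^tp_X)^Θ` Hausdorff). [cite: MochizukiEtTh2009, Prop 1.5 (i) p.23] -/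
theorem res_deltaTheta_surjective_of_complement_of_tendsto_zpow [T2Space D.GtpTheta]
    {H' K : Subgroup D.GtpTheta} (hΔ : D.DeltaTheta ≤ H') (hdisj : Disjoint D.DeltaTheta K)
    (π : H' → D.DeltaTheta) (hπK : ∀ h : H', ((π h : D.GtpTheta))⁻¹ * (h : D.GtpTheta) ∈ K)
    (hπc : Continuous π)
    (hpow : ∀ k : D.GtpTheta, k ∈ K → ∃ l : Filter ℤ, l.NeBot ∧
      ∀ a a' : D.DeltaTheta, k * a * k⁻¹ = a' → Tendsto (fun n : ℤ => a ^ n) l (𝓝 a')) :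
    Function.Surjective
      (ContH1.res (MonoidHom.id D.GtpTheta) D.DeltaTheta hΔ : D.H1Theta H' → D.H1Theta D.DeltaTheta) :=
  ContH1.res_surjective_of_complement_of_tendsto_zpow hΔ hdisj π hπK hπc hpow

end ThetaSetting

end Literature.AnabelianGeometry.EtaleTheta

/-! ### v2 (gen 4): the power-limit hypothesis from a continuous `Ẑ`-power map (plug-in form)

At a model the conjugation action on `Δ_Θ ≅ Ẑ(1)` is `a ↦ a^{χ(k)}` for a CONTINUOUS extension
`t ↦ a^t` of the integer powers to a completion `Z ⊇ ℤ` (dense image) and `χ(k) ∈ Z`. The hypothesis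
`hpow` of `res_surjective_of_complement_of_tendsto_zpow` then holds with the filter
`comap ι (𝓝 (χ k))` — recorded here once, for any dense `ι : ℤ → Z`, so that consumers only supply the
power map and the conjugation formula. [cite: Brown1982CohomologyGroups, Ch. IV §2 Prop. 2.1 and Prop. 2.3] -/

namespace Literature.AnabelianGeometry.EtaleTheta

open Filter Topology

namespace ContH1

section PlugIn

variable {G : Type*} [Group G] {A : Subgroup G} [TopologicalSpace A]
  {Z : Type*} [TopologicalSpace Z]

/-- **Plug-in form of the power-limit hypothesis.** If `ι : ℤ → Z` has dense range, `Φ a : Z → A` is a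
continuous extension of the integer powers of `a` (`Φ a (ι n) = aⁿ`) for every `a ∈ A`, and `k`
conjugates each `a ∈ A` to `Φ a u` for ONE `u ∈ Z` (e.g. `u = χ(k)`), then conjugation by `k` is a
pointwise limit of power maps along the non-trivial filter `comap ι (𝓝 u)`.
[cite: Brown1982CohomologyGroups, Ch. IV §2 Prop. 2.1 and Prop. 2.3] -/
theorem exists_tendsto_zpow_of_denseRange (ι : ℤ → Z) (hι : DenseRange ι) (Φ : A → Z → A)
    (hΦc : ∀ a, Continuous (Φ a)) (hΦι : ∀ a (n : ℤ), Φ a (ι n) = a ^ n) (u : Z) (k : G)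
    (hk : ∀ a : A, k * (a : G) * k⁻¹ = (Φ a u : G)) :
    ∃ l : Filter ℤ, l.NeBot ∧
      ∀ a a' : A, k * (a : G) * k⁻¹ = a' → Tendsto (fun n : ℤ => a ^ n) l (𝓝 a') := by
  have hne : (comap ι (𝓝 u)).NeBot :=
    ((hι.nhdsWithin_neBot u).comap_of_range_mem self_mem_nhdsWithin).mono
      (comap_mono nhdsWithin_le_nhds)
  refine ⟨comap ι (𝓝 u), hne, fun a a' h => ?_⟩
  have ha' : a' = Φ a u := Subtype.ext ((h.symm.trans (hk a)))
  have h1 : Tendsto (fun n : ℤ => Φ a (ι n)) (comap ι (𝓝 u)) (𝓝 (Φ a u)) :=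
    ((hΦc a).tendsto u).comp tendsto_comap
  rw [ha']
  simpa only [hΦι] using h1

end PlugIn

end ContH1

namespace ThetaSetting

open Literature.AnabelianGeometry.SemiGraphs

variable {p : ℕ} [Fact p.Prime] {D : ThetaSetting p}

/-- **`res_deltaTheta_surjective` at a «cyclotomic semidirect» presentation, plug-in form**: a topological
splitting `H' = Δ_Θ ⋊ K`, a dense `ι : ℤ → Z`, continuous power maps `Φ a : Z → Δ_Θ` extending `n ↦ aⁿ`,
and a function `χ : K → Z` with `k a k⁻¹ = Φ a (χ k)` give the clause `res_deltaTheta_surjective` of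
`Prop15i`/`Prop15ii` outright ("`F⁰/F¹ = Hom(Δ_Θ, Δ_Θ)`", Prop. 1.5 (i)(ii), p. 23).
[cite: MochizukiEtTh2009, Prop 1.5 (i) p.23] -/
theorem res_deltaTheta_surjective_of_complement_of_powMap [T2Space D.GtpTheta]
    {H' K : Subgroup D.GtpTheta} (hΔ : D.DeltaTheta ≤ H') (hdisj : Disjoint D.DeltaTheta K)
    (π : H' → D.DeltaTheta) (hπK : ∀ h : H', ((π h : D.GtpTheta))⁻¹ * (h : D.GtpTheta) ∈ K)
    (hπc : Continuous π) {Z : Type*} [TopologicalSpace Z] (ι : ℤ → Z) (hι : DenseRange ι)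
    (Φ : D.DeltaTheta → Z → D.DeltaTheta) (hΦc : ∀ a, Continuous (Φ a))
    (hΦι : ∀ a (n : ℤ), Φ a (ι n) = a ^ n) (χ : D.GtpTheta → Z)
    (hχ : ∀ k : D.GtpTheta, k ∈ K → ∀ a : D.DeltaTheta,
      k * (a : D.GtpTheta) * k⁻¹ = (Φ a (χ k) : D.GtpTheta)) :
    Function.Surjective
      (ContH1.res (MonoidHom.id D.GtpTheta) D.DeltaTheta hΔ : D.H1Theta H' → D.H1Theta D.DeltaTheta) :=
  res_deltaTheta_surjective_of_complement_of_tendsto_zpow hΔ hdisj π hπK hπc fun k hk =>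
    ContH1.exists_tendsto_zpow_of_denseRange ι hι Φ hΦc hΦι (χ k) k (hχ k hk)

end ThetaSetting

end Literature.AnabelianGeometry.EtaleTheta
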